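import Literature.Analysis.FluidPDE.CylindricalIntegration
import HarnessLib

/-!
# Integration by parts in `r` against `1/r` with the axis boundary term

Analysis/FluidPDE proofs file (theorems only), companion of `CylindricalIntegration` (which
proves, for axisymmetric `C¹` scalars `F`, `φ` with `φ` compactly supported **and `F = 0` on the
axis**, `∫ (2/r) ∂ᵣF φ dx = −∫ (2/r) F ∂ᵣφ dx`, KNSS 2009 (5.19)–(5.20)). Here the vanishing on
the axis is dropped and the boundary term is kept:

`∫ (2/r) ∂ᵣF φ dx = −∫ (2/r) F ∂ᵣφ dx − 2c₂ ∫ F(0,0,z) φ(0,0,z) dz`, `c₂ = 2|B₁(ℝ²)| = 2π`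

(`integral_two_div_cylRadius_mul_fderiv_eR_axis`; with `F = 0` on the axis the last term
vanishes). This is the form needed when the equation (1.5)
`∂ₜΦ + b·∇Φ + (2/r)∂ᵣΦ = ΔΦ` of Lei–Zhang, J. Funct. Anal. 261 (2011) = arXiv:1011.5066, is
tested for the *normalised* positive solution `Φ = 2(M − Γ)/J`, which is a non-zero constant
`a` on the axis: Lemma 3.4 there, display after (3.?) "`−∬ (2/r)(∂ᵣΦ^p)ψ² = ∬ Φ^p (4/|y'|) ψ ∂_{|y'|}ψ + ∫ds∫ 2Φ^pψ²|_{r=0} dz`",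
p. 11, and Lemma 3.2, "`−∫ (4π/r)∂ᵣΨ ζ² r dr dθ dz = −4π∫(Ψ−Ψ̄)ζ² dz|_{r=0}^{r=∞} + …`", p. 9.
The proof is that of the tree lemma (radial reduction `dx = r dr dθ dz`, the fundamental theorem
of calculus on each ray, domination by `C·1_box/r`), keeping `(Fφ)(0,0,z)`.

## References

* Z. Lei, Q. S. Zhang, J. Funct. Anal. 261 (2011) = arXiv:1011.5066, §3, proof of Lemma 3.2
  (p. 9) and of Lemma 3.4 (p. 11): the axis terms. [LeiZhang2011]
* G. Koch, N. Nadirashvili, G. Seregin, V. Šverák, Acta Math. 203 (2009), (5.19)–(5.20).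
  [KochNadirashviliSereginSverak2009]
-/

noncomputable section

open MeasureTheory Set Function Filter Topology TopologicalSpace WithLp Metric
open scoped RealInnerProductSpace ENNReal

namespace Literature.Analysis.FluidPDE

/-- **Integration by parts in `r` against the weight `1/r`, with the axis boundary term.** For
axisymmetric `C¹` scalars `F`, `φ` on `ℝ³` with `φ` compactly supported, both
`(2/r) ∂ᵣF φ` and `(2/r) F ∂ᵣφ` are integrable and
`∫ (2/r) ∂ᵣF φ dx = −∫ (2/r) F ∂ᵣφ dx − 2c₂ ∫ F(0,0,z) φ(0,0,z) dz` (`c₂ = radialConst₂ = 2π`,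
`(0,0,z) = meridianPoint (0, z)`): the sum of the two volume integrals is the integral of the
axisymmetric scalar `(2/r)∂ᵣ(Fφ)`, i.e. `∫ dz c₂ ∫₀^∞ 2 ∂_ρ[(Fφ)(ρ,0,z)] dρ = −2c₂ ∫ (Fφ)(0,0,z) dz`.
This is the axis term of Lei–Zhang 2011, Lemmas 3.2 and 3.4 ("`+ ∫ 2Φ^p ψ²|_{r=0} dz`"); the
tree's `integral_two_div_cylRadius_mul_fderiv_eR` is the case `F = 0` on the axis. [cite: LeiZhang2011, proof of Lemma 3.4 (arXiv p. 11), the axis boundary term] -/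
theorem integrable_and_integral_two_div_cylRadius_mul_fderiv_eR_axis {F φ : (EuclideanSpace ℝ (Fin 3)) → ℝ}
    (hF : ContDiff ℝ 1 F) (hφ : ContDiff ℝ 1 φ) (hφc : HasCompactSupport φ)
    (hFa : IsAxisymmetricScalar F) (hφa : IsAxisymmetricScalar φ) :
    Integrable (fun x => 2 / cylRadius x * (fderiv ℝ F x (eR x) * φ x)) ∧
    Integrable (fun x => 2 / cylRadius x * (F x * fderiv ℝ φ x (eR x))) ∧
    ∫ x, 2 / cylRadius x * (fderiv ℝ F x (eR x) * φ x) =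
      (-∫ x, 2 / cylRadius x * (F x * fderiv ℝ φ x (eR x))) -
        2 * radialConst₂ * ∫ z : ℝ, F (meridianPoint (0, z)) * φ (meridianPoint (0, z)) := by
  have hFd : Differentiable ℝ F := hF.differentiable one_ne_zero
  have hφd : Differentiable ℝ φ := hφ.differentiable one_ne_zero
  -- a cylinder box containing the support of `φ`
  obtain ⟨R, hR⟩ : ∃ R : ℝ, tsupport φ ⊆ closedBall (0 : (EuclideanSpace ℝ (Fin 3))) R :=
    (hφc.isCompact.isBounded).subset_closedBall 0
  have hK : tsupport φ ⊆ solidCylinder R R := hR.trans (closedBall_subset_solidCylinder R)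
  -- uniform (nonnegative) bounds on the compact support
  obtain ⟨CF, hCF0, hCF⟩ : ∃ C, 0 ≤ C ∧ ∀ x ∈ tsupport φ, |F x| ≤ C := by
    obtain ⟨C, hC⟩ := hφc.isCompact.exists_bound_of_continuousOn hF.continuous.continuousOn
    exact ⟨|C|, abs_nonneg C, fun x hx => by
      simpa [Real.norm_eq_abs] using (hC x hx).trans (le_abs_self C)⟩
  obtain ⟨CDF, hCDF0, hCDF⟩ : ∃ C, 0 ≤ C ∧ ∀ x ∈ tsupport φ, ‖fderiv ℝ F x‖ ≤ C := by
    obtain ⟨C, hC⟩ := hφc.isCompact.exists_bound_of_continuousOn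
      (hF.continuous_fderiv one_ne_zero).continuousOn
    exact ⟨|C|, abs_nonneg C, fun x hx => (hC x hx).trans (le_abs_self C)⟩
  obtain ⟨Cφ, hCφ0, hCφ⟩ : ∃ C, 0 ≤ C ∧ ∀ x, |φ x| ≤ C := by
    obtain ⟨C, hC⟩ := hφ.continuous.bounded_above_of_compact_support hφc
    exact ⟨|C|, abs_nonneg C, fun x => by
      simpa [Real.norm_eq_abs] using (hC x).trans (le_abs_self C)⟩
  obtain ⟨CDφ, hCDφ0, hCDφ⟩ : ∃ C, 0 ≤ C ∧ ∀ x, ‖fderiv ℝ φ x‖ ≤ C := by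
    obtain ⟨C, hC⟩ := (hφ.continuous_fderiv one_ne_zero).bounded_above_of_compact_support
      (hφc.fderiv (𝕜 := ℝ))
    exact ⟨|C|, abs_nonneg C, fun x => (hC x).trans (le_abs_self C)⟩
  have heR : ∀ x, ‖eR x‖ ≤ 1 := fun x => by
    by_cases hx : cylRadius x = 0
    · simp [eR, hx]
    · rw [eR, norm_smul, norm_inv, Real.norm_eq_abs, abs_of_nonneg (cylRadius_nonneg x)]
      have : ‖(toLp 2 ![x 0, x 1, 0] : (EuclideanSpace ℝ (Fin 3)))‖ = cylRadius x := by
        rw [cylRadius, EuclideanSpace.norm_eq, Fin.sum_univ_three]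
        simp [Real.norm_eq_abs, sq_abs]
      rw [this, inv_mul_cancel₀ hx]
  have hDF_le : ∀ x ∈ tsupport φ, |fderiv ℝ F x (eR x)| ≤ CDF := fun x hx => by
    rw [← Real.norm_eq_abs]
    exact ((fderiv ℝ F x).le_opNorm _).trans
      ((mul_le_of_le_one_right (norm_nonneg _) (heR x)).trans (hCDF x hx))
  have hDφ_le : ∀ x, |fderiv ℝ φ x (eR x)| ≤ CDφ := fun x => by
    rw [← Real.norm_eq_abs]
    exact ((fderiv ℝ φ x).le_opNorm _).trans
      ((mul_le_of_le_one_right (norm_nonneg _) (heR x)).trans (hCDφ x))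
  -- the two integrands
  set G₁ : (EuclideanSpace ℝ (Fin 3)) → ℝ := fun x => 2 / cylRadius x * (fderiv ℝ F x (eR x) * φ x) with hG₁
  set G₂ : (EuclideanSpace ℝ (Fin 3)) → ℝ := fun x => 2 / cylRadius x * (F x * fderiv ℝ φ x (eR x)) with hG₂
  -- measurability
  have hmeR : Measurable eR := by
    have h1 : Measurable fun x : (EuclideanSpace ℝ (Fin 3)) => (cylRadius x)⁻¹ := continuous_cylRadius.measurable.inv
    have h2 : Continuous fun x : (EuclideanSpace ℝ (Fin 3)) => (toLp 2 ![x 0, x 1, 0] : (EuclideanSpace ℝ (Fin 3))) := by fun_prop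
    exact h1.smul h2.measurable
  have happly : Measurable fun p : ((EuclideanSpace ℝ (Fin 3)) →L[ℝ] ℝ) × (EuclideanSpace ℝ (Fin 3)) => p.1 p.2 :=
    (isBoundedBilinearMap_apply (𝕜 := ℝ) (E := (EuclideanSpace ℝ (Fin 3))) (F := ℝ)).continuous.measurable
  have hmDF : Measurable fun x => fderiv ℝ F x (eR x) :=
    happly.comp ((hF.continuous_fderiv one_ne_zero).measurable.prodMk hmeR)
  have hmDφ : Measurable fun x => fderiv ℝ φ x (eR x) :=
    happly.comp ((hφ.continuous_fderiv one_ne_zero).measurable.prodMk hmeR)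
  have hm2r : Measurable fun x : (EuclideanSpace ℝ (Fin 3)) => 2 / cylRadius x :=
    measurable_const.div continuous_cylRadius.measurable
  have hmG₁ : AEStronglyMeasurable G₁ volume :=
    (hm2r.mul (hmDF.mul hφ.continuous.measurable)).aestronglyMeasurable
  have hmG₂ : AEStronglyMeasurable G₂ volume :=
    (hm2r.mul (hF.continuous.measurable.mul hmDφ)).aestronglyMeasurable
  -- domination by `C · 1_box · r⁻¹`
  set C : ℝ := 2 * (CDF * Cφ + CF * CDφ) with hC
  have hCnn : 0 ≤ C := by positivity
  have hdom := ((integrableOn_inv_cylRadius_solidCylinder R R).integrable_indicator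
    (measurableSet_solidCylinder R R)).const_mul C
  have hsupp : ∀ x, x ∉ tsupport φ → φ x = 0 ∧ fderiv ℝ φ x = 0 := fun x hx =>
    ⟨image_eq_zero_of_notMem_tsupport hx, fderiv_of_notMem_tsupport ℝ hx⟩
  have hind0 : ∀ x, 0 ≤ (solidCylinder R R).indicator (fun x => (cylRadius x)⁻¹) x := fun x =>
    indicator_nonneg (fun y _ => inv_nonneg.2 (cylRadius_nonneg y)) x
  have hbound : ∀ {a b : ℝ} (x : (EuclideanSpace ℝ (Fin 3))), |a| * |b| ≤ CDF * Cφ + CF * CDφ →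
      (x ∉ tsupport φ → a * b = 0) →
      ‖2 / cylRadius x * (a * b)‖ ≤ C * (solidCylinder R R).indicator (fun x => (cylRadius x)⁻¹) x := by
    intro a b x hab hzero
    rw [Real.norm_eq_abs]
    by_cases hx : x ∈ tsupport φ
    · rw [indicator_of_mem (hK hx), abs_mul, abs_div, abs_two,
        abs_of_nonneg (cylRadius_nonneg x), abs_mul, div_eq_mul_inv, hC]
      have hr : 0 ≤ (cylRadius x)⁻¹ := inv_nonneg.2 (cylRadius_nonneg x)
      nlinarith
    · rw [hzero hx, mul_zero, abs_zero]
      exact mul_nonneg hCnn (hind0 x)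
  have hbound₁ : ∀ x, ‖G₁ x‖ ≤ C * (solidCylinder R R).indicator (fun x => (cylRadius x)⁻¹) x := by
    intro x
    refine hbound x ?_ fun hx => by rw [(hsupp x hx).1, mul_zero]
    by_cases hx : x ∈ tsupport φ
    · nlinarith [hDF_le x hx, hCφ x, abs_nonneg (fderiv ℝ F x (eR x)), abs_nonneg (φ x),
        mul_nonneg hCF0 hCDφ0]
    · rw [(hsupp x hx).1, abs_zero, mul_zero]
      positivity
  have hbound₂ : ∀ x, ‖G₂ x‖ ≤ C * (solidCylinder R R).indicator (fun x => (cylRadius x)⁻¹) x := by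
    intro x
    refine hbound x ?_ fun hx => by
      rw [(hsupp x hx).2, zero_apply, mul_zero]
    by_cases hx : x ∈ tsupport φ
    · nlinarith [hCF x hx, hDφ_le x, abs_nonneg (fderiv ℝ φ x (eR x)), abs_nonneg (F x),
        mul_nonneg hCDF0 hCφ0]
    · rw [(hsupp x hx).2, zero_apply, abs_zero, mul_zero]
      positivity
  have hint₁ : Integrable G₁ := hdom.mono' hmG₁ (Eventually.of_forall hbound₁)
  have hint₂ : Integrable G₂ := hdom.mono' hmG₂ (Eventually.of_forall hbound₂)
  -- the sum is the axisymmetric scalar `(2/r) ∂ᵣ(Fφ)`; its integral vanishes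
  have hsum_axi : IsAxisymmetricScalar fun x => G₁ x + G₂ x := by
    have h1 := hFa.fderiv_apply_eR hFd
    have h2 := hφa.fderiv_apply_eR hφd
    intro θ x
    simp only [hG₁, hG₂, cylRadius_rotZ, h1 θ x, h2 θ x, hFa θ x, hφa θ x]
  have hsum_eq : ∫ x, (G₁ x + G₂ x) =
      -(2 * radialConst₂ * ∫ z : ℝ, F (meridianPoint (0, z)) * φ (meridianPoint (0, z))) := by
    rw [hsum_axi.integral_eq (hint₁.add hint₂), ← integral_const_mul, ← integral_neg]
    refine integral_congr_ae (Eventually.of_forall fun z => ?_)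
    dsimp only
    -- on the slice `z`: `∫₀^∞ ρ (G₁ + G₂)(ρ,0,z) dρ = ∫₀^∞ 2 (Fφ)'(ρ) dρ = -2 (Fφ)(0,0,z)`
    set P : ℝ → ℝ := fun ρ => F (meridianPoint (ρ, z)) * φ (meridianPoint (ρ, z)) with hP
    set P' : ℝ → ℝ := fun ρ => fderiv ℝ F (meridianPoint (ρ, z)) (EuclideanSpace.single 0 1) *
      φ (meridianPoint (ρ, z)) + F (meridianPoint (ρ, z)) * fderiv ℝ φ (meridianPoint (ρ, z)) (EuclideanSpace.single 0 1)
      with hP'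
    have hPd : ∀ ρ, HasDerivAt P (P' ρ) ρ := fun ρ =>
      (hasDerivAt_comp_meridianPoint_fst z (hFd _)).mul (hasDerivAt_comp_meridianPoint_fst z (hφd _))
    have heq : EqOn (fun ρ => ρ • (G₁ (meridianPoint (ρ, z)) + G₂ (meridianPoint (ρ, z)))) (fun ρ => 2 * P' ρ)
        (Ioi 0) := by
      intro ρ hρ
      have hρ' : (0 : ℝ) < ρ := hρ
      simp only [hG₁, hG₂, hP', smul_eq_mul, cylRadius_meridianPoint_eq_abs, abs_of_pos hρ', eR_meridianPoint hρ']
      field_simp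
    rw [setIntegral_congr_fun measurableSet_Ioi heq, integral_const_mul]
    -- `P'` vanishes off `[-R-1, R+1]`, `P → 0`, and `P 0 = 0`
    have hout : ∀ ρ, R < |ρ| → meridianPoint (ρ, z) ∉ tsupport φ := by
      intro ρ hρ hmem
      have h1 := hK hmem
      simp only [solidCylinder, mem_setOf_eq, cylRadius_meridianPoint_eq_abs] at h1
      linarith [h1.1]
    have hP'zero : ∀ ρ, R < |ρ| → P' ρ = 0 := fun ρ hρ => by
      simp only [hP', (hsupp _ (hout ρ hρ)).1, (hsupp _ (hout ρ hρ)).2,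
        zero_apply, mul_zero, zero_add]
    have hc : Continuous fun ρ : ℝ => meridianPoint (ρ, z) :=
      continuous_iff_continuousAt.2 fun ρ => (hasDerivAt_meridianPoint_fst ρ z).continuousAt
    have hP'c : Continuous P' := by
      have h1 : Continuous fun ρ => fderiv ℝ F (meridianPoint (ρ, z)) (EuclideanSpace.single 0 1) :=
        ((hF.continuous_fderiv one_ne_zero).comp hc).clm_apply continuous_const
      have h2 : Continuous fun ρ => fderiv ℝ φ (meridianPoint (ρ, z)) (EuclideanSpace.single 0 1) :=
        ((hφ.continuous_fderiv one_ne_zero).comp hc).clm_apply continuous_const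
      simp only [hP']
      exact (h1.mul (hφ.continuous.comp hc)).add ((hF.continuous.comp hc).mul h2)
    have hP'int : IntegrableOn P' (Ioi 0) := by
      refine (Continuous.integrable_of_hasCompactSupport hP'c ?_).integrableOn
      refine HasCompactSupport.intro (isCompact_Icc (a := -(R + 1)) (b := R + 1)) fun ρ hρ => ?_
      apply hP'zero
      simp only [mem_Icc, not_and_or, not_le] at hρ
      rcases hρ with hρ | hρ
      · linarith [neg_le_abs ρ]
      · linarith [le_abs_self ρ]
    have hPlim : Tendsto P atTop (𝓝 0) := by
      apply tendsto_const_nhds.congr'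
      filter_upwards [eventually_gt_atTop |R|] with ρ hρ
      have hρ' : R < |ρ| := (le_abs_self R).trans_lt (hρ.trans_le (le_abs_self ρ))
      simp only [hP, (hsupp _ (hout ρ hρ')).1, mul_zero]
    rw [integral_Ioi_of_hasDerivAt_of_tendsto' (fun ρ _ => hPd ρ) hP'int hPlim]
    simp only [hP, smul_eq_mul]
    ring
  -- conclude
  rw [integral_add hint₁ hint₂] at hsum_eq
  have h1 : (∫ x, G₁ x) = -(∫ x, G₂ x) -
      2 * radialConst₂ * ∫ z : ℝ, F (meridianPoint (0, z)) * φ (meridianPoint (0, z)) := by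
    linarith
  exact ⟨hint₁, hint₂, h1⟩


end Literature.Analysis.FluidPDE
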